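import Summits.QuantumFields.YangMills.Theorems.VirialFluxGapFixFrame
import Summits.QuantumFields.YangMills.Theorems.VirialFluxGapRingFrameLog
import HarnessLib

/-!
# Route `VirialFluxGap` (YangMills): the LOGARITHMIC CHART of the tree-gauged frame family `fixFrame` — a nearby ring history with the same
# slice-0 tree links is `Q = P·exp(Y_u)` with `u` in `fixFrame` coordinates and `|u|² ≤ 12·Σ_w‖Q_w − P_w‖²`; slot norm `‖fixFrame‖_F ≤ √2`

Toward the deciding crux `VirialFluxGap.PeriodicSoftness` (item stmt-QuantumFields-24141), generic-region Euler field ON THE TREE-GAUGED HOST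
`X_fix` (LEAD ruling 2026-08-30T23:30:33Z; memo `fcl-p3-g40-RESOLVENT-EULER-FIELD-24141.md`).  The master estimates for frames of any slot norm
(⧗`generic_drive_lower_of_norm_le` ∕ `generic_divergence_upper_of_norm_le`) are applied on `X_fix` with w2's frame family ✓`FixFrame.fixFrame`
(`E_a = quatMatrix (zUnit a)` at each `X_fix` variable).  They take coordinates `u` with `P·exp(Y_u)` a zero of `F₀`; this file is the chart
producing such `u` from a NEARBY ring history `Q` that agrees with `P` on the slice-0 tree links (both tree-gauged):

* §1 `fixCoord3 Y = (Im Y₀₀, Re Y₀₁, Im Y₀₁)`, ★ `quatMatrix_fixCoord3` (a skew-Hermitian traceless `Y` is `quatMatrix ⟨0, fixCoord3 Y⟩`),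
  `abs_fixCoord3_le` (`≤ ‖Y‖_F`), ★ `norm_fixFrame_le` (`‖fixFrame va w‖_F ≤ √2` — the `B` of the scaled master estimates);
* §2 `fixCoord Y (v,a) = fixCoord3 (Y (fixVar v)) a`, ★★ `dirOf_fixFrame_fixCoord` (`dirOf fixFrame (fixCoord Y) = Y` when `Y` vanishes on the
  slice-0 tree links), `fixCoord_sq_le` (`|fixCoord Y|² ≤ 3·Σ_w ‖Y w‖²`);
* §3 ★★★ `exists_fixCoord_of_near`: `Q_0e = P_0e` on tree links and `‖Q_w − P_w‖_F < 1/4` slot by slot ⇒ ∃ u, `P·multiCurve (dirOf fixFrame u) 1 = Q`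
  and `u·u ≤ 12·(Σ_{i,e}‖Q.1 i e − P.1 i e‖² + Σ_x‖Q.2 x − P.2 x‖²)` (over ✓`exists_multiCurve_eq_of_near`).

HONEST LABEL: a chart; the quadratic-growth constant on `X_fix` (distance of the tree-gauge fixing of w2's nearby flat ring) and the Euler field
assembly are NOT here; ⟨24141⟩, ⟨22884⟩ remain OPEN; the Yang–Mills mass gap is NOT proved; no summit is proved by a line.  DEFINITIONS
`fixCoord3`, `fixCoord` + theorems (0 `sorry`), standard axioms.  Explicit-unit seat `ym-line-fcl-p3` g40 (cell ym-idea-1, free hands),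
`--supports stmt-QuantumFields-24141`.  References: [folklore].
-/

set_option autoImplicit false

noncomputable section

open scoped Matrix BigOperators ContDiff Topology Quaternion
open MeasureTheory Set Matrix
open Literature.MathematicalPhysics.QuantumFieldTheory hiding SU2
open Literature.MathematicalPhysics.QuantumLattice
open Literature.MathematicalPhysics.QuantumFieldTheory.SUNBakryEmery (expSU coe_expSU matTop)

namespace Summit.QuantumFields.YangMills.Theorems.VirialFluxGap.FrameHessian

open Summit.QuantumFields.YangMills.Theorems.FemtoTransferGap
open Summit.QuantumFields.YangMills.Theorems.FemtoTransferGap.TT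
open Summit.QuantumFields.YangMills.Theorems.VirialFluxGap.RingDeficit
open Summit.QuantumFields.YangMills.Theorems.VirialFluxGap.FrameDerivative
open Summit.QuantumFields.YangMills.Theorems.VirialFluxGap.FixFrame

open scoped Matrix.Norms.Frobenius

/-! ## §1 Coordinates of one slot in the basis `E_a = quatMatrix (zUnit a)` -/

/-- The coordinates of a `2×2` matrix in the basis `E_0 = diag(i,−i)`, `E_1 = [[0,1],[−1,0]]`, `E_2 = [[0,i],[i,0]]`: `(Im Y₀₀, Re Y₀₁, Im Y₀₁)`.
[folklore] -/
def fixCoord3 (Y : Matrix (Fin 2) (Fin 2) ℂ) : Fin 3 → ℝ := ![(Y 0 0).im, (Y 0 1).re, (Y 0 1).im]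

/-- The three coordinates, by cases. [folklore] -/
@[simp] theorem fixCoord3_zero (Y : Matrix (Fin 2) (Fin 2) ℂ) : fixCoord3 Y 0 = (Y 0 0).im := rfl

/-- The three coordinates, by cases. [folklore] -/
@[simp] theorem fixCoord3_one (Y : Matrix (Fin 2) (Fin 2) ℂ) : fixCoord3 Y 1 = (Y 0 1).re := rfl

/-- The three coordinates, by cases. [folklore] -/
@[simp] theorem fixCoord3_two (Y : Matrix (Fin 2) (Fin 2) ℂ) : fixCoord3 Y 2 = (Y 0 1).im := rfl

/-- ★ A skew-Hermitian traceless `2×2` matrix is the quaternion matrix of its coordinates: `Y = quatMatrix ⟨0, Im Y₀₀, Re Y₀₁, Im Y₀₁⟩`. [folklore] -/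
theorem quatMatrix_fixCoord3 {Y : Matrix (Fin 2) (Fin 2) ℂ} (hY : Yᴴ = -Y) (hY0 : Y.trace = 0) :
    quatMatrix (⟨0, fixCoord3 Y 0, fixCoord3 Y 1, fixCoord3 Y 2⟩ : ℍ) = Y := by
  have h00 := congr_fun (congr_fun hY 0) 0
  have h01 := congr_fun (congr_fun hY 0) 1
  simp only [Matrix.conjTranspose_apply, Matrix.neg_apply] at h00 h01
  rw [Matrix.trace_fin_two] at hY0
  have hre00 : (Y 0 0).re = 0 := by
    have := congrArg Complex.re h00; simp at this; linarith
  have h10re : (Y 1 0).re = -(Y 0 1).re := by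
    have := congrArg Complex.re h01; simp at this; linarith
  have h10im : (Y 1 0).im = (Y 0 1).im := by
    have := congrArg Complex.im h01; simp at this; linarith
  have h11re : (Y 1 1).re = 0 := by
    have := congrArg Complex.re hY0; simp at this; linarith
  have h11im : (Y 1 1).im = -(Y 0 0).im := by
    have := congrArg Complex.im hY0; simp at this; linarith
  ext i j
  fin_cases i <;> fin_cases j <;> simp [quatMatrix, Complex.ext_iff, hre00, h10re, h10im, h11re, h11im]

/-- ★ Expansion in the basis: `Σ_a (fixCoord3 Y)_a · E_a = Y` for skew-Hermitian traceless `Y`. [folklore] -/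
theorem sum_fixCoord3_smul {Y : Matrix (Fin 2) (Fin 2) ℂ} (hY : Yᴴ = -Y) (hY0 : Y.trace = 0) :
    ∑ a, fixCoord3 Y a • quatMatrix (zUnit a) = Y := by
  rw [sum_smul_quatMatrix_zUnit]
  exact quatMatrix_fixCoord3 hY hY0

/-- The coordinates are bounded by the Frobenius norm: `|(fixCoord3 Y)_a| ≤ ‖Y‖_F` (entries are bounded by the Frobenius norm).
[folklore] -/
theorem abs_fixCoord3_le (Y : Matrix (Fin 2) (Fin 2) ℂ) (a : Fin 3) : |fixCoord3 Y a| ≤ ‖Y‖ := by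
  have hentry : ∀ i j, ‖Y i j‖ ≤ ‖Y‖ := by
    intro i j
    have h : ‖Y i j‖₊ ≤ ‖Y‖₊ := by
      rw [Matrix.frobenius_nnnorm_def]
      have h1 : ‖Y i j‖₊ ^ (2 : ℝ) ≤ ∑ i', ∑ j', ‖Y i' j'‖₊ ^ (2 : ℝ) :=
        le_trans (Finset.single_le_sum (f := fun j' => ‖Y i j'‖₊ ^ (2 : ℝ)) (fun _ _ => by positivity) (Finset.mem_univ j))
          (Finset.single_le_sum (f := fun i' => ∑ j', ‖Y i' j'‖₊ ^ (2 : ℝ)) (fun _ _ => by positivity) (Finset.mem_univ i))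
      calc ‖Y i j‖₊ = (‖Y i j‖₊ ^ (2 : ℝ)) ^ (1 / 2 : ℝ) := by rw [← NNReal.rpow_mul]; norm_num
        _ ≤ (∑ i', ∑ j', ‖Y i' j'‖₊ ^ (2 : ℝ)) ^ (1 / 2 : ℝ) := NNReal.rpow_le_rpow h1 (by norm_num)
    exact_mod_cast h
  fin_cases a
  · exact (Complex.abs_im_le_norm _).trans (hentry 0 0)
  · exact (Complex.abs_re_le_norm _).trans (hentry 0 1)
  · exact (Complex.abs_im_le_norm _).trans (hentry 0 1)

/-- `Σ_a (fixCoord3 Y)_a² ≤ 3‖Y‖_F²`. [folklore] -/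
theorem sum_fixCoord3_sq_le (Y : Matrix (Fin 2) (Fin 2) ℂ) : ∑ a, fixCoord3 Y a ^ 2 ≤ 3 * ‖Y‖ ^ 2 := by
  have h : ∀ a, fixCoord3 Y a ^ 2 ≤ ‖Y‖ ^ 2 := fun a => by
    rw [← sq_abs]
    exact pow_le_pow_left₀ (abs_nonneg _) (abs_fixCoord3_le Y a) 2
  calc ∑ a, fixCoord3 Y a ^ 2 ≤ ∑ _a : Fin 3, ‖Y‖ ^ 2 := Finset.sum_le_sum fun a _ => h a
    _ = 3 * ‖Y‖ ^ 2 := by rw [Finset.sum_const, Finset.card_univ, Fintype.card_fin]; ring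

/-- ★ The Frobenius slot norm of the frame family of `X_fix`: `‖fixFrame va w‖_F ≤ √2` (the basis matrices `E_a` are in `SU(2)`; this is the `B`
of ⧗`generic_drive_lower_of_norm_le` ∕ `generic_divergence_upper_of_norm_le` for `fixFrame`). [folklore] -/
theorem norm_fixFrame_le {L : ℕ} (va : FixVar L × Fin 3) (w : ((Fin (2 * L - 1 + 1) × Edge 3 L) ⊕ Site 3 L)) : ‖fixFrame va w‖ ≤ Real.sqrt 2 := by
  have key : ∀ a : Fin 3, ‖quatMatrix (zUnit a)‖ ≤ Real.sqrt 2 := by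
    intro a
    have h2 : ‖quatMatrix (zUnit a)‖ ^ 2 = 2 := by
      rw [← frobNorm_eq_norm, frobNorm_sq]
      simp only [Fin.sum_univ_two, quatMatrix_apply_00, quatMatrix_apply_01, quatMatrix_apply_10, quatMatrix_apply_11, zUnit,
        ← Complex.normSq_eq_norm_sq, Complex.normSq_mk]
      fin_cases a <;> simp <;> norm_num
    rw [← Real.sqrt_sq (norm_nonneg (quatMatrix (zUnit a))), h2]
  unfold fixFrame
  split_ifs
  · exact key _
  · rw [norm_zero]; positivity

/-! ## §2 Coordinates of a ring assignment in the frame family of `X_fix` -/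

variable {L : ℕ} [NeZero L]

omit [NeZero L] in
/-- The `fixFrame` coordinates of an assignment `Y` on the ring variables: at the `X_fix` variable `v`, the three coordinates of `Y (fixVar v)`.
[folklore] -/
def fixCoord (Y : ((Fin (2 * L - 1 + 1) × Edge 3 L) ⊕ Site 3 L) → Matrix (Fin 2) (Fin 2) ℂ) (va : FixVar L × Fin 3) : ℝ := fixCoord3 (Y (fixVar va.1)) va.2

/-- ★★ **The chart is onto the assignments vanishing on the slice-0 tree**: `dirOf fixFrame (fixCoord Y) = Y` whenever `Y` is skew-Hermitian,
traceless and `0` on the tree links of slice `0`. [folklore] -/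
theorem dirOf_fixFrame_fixCoord {Y : ((Fin (2 * L - 1 + 1) × Edge 3 L) ⊕ Site 3 L) → Matrix (Fin 2) (Fin 2) ℂ} (hY : ∀ w, (Y w)ᴴ = -Y w) (hY0 : ∀ w, (Y w).trace = 0)
    (htree : ∀ e : Edge 3 L, treeEdge e = true → Y (Sum.inl (0, e)) = 0) :
    dirOf (fixFrame (L := L)) (fixCoord Y) = Y := by
  funext w
  rcases exists_fixVar_or_tree w with ⟨v, rfl⟩ | ⟨e, he, rfl⟩
  · rw [dirOf_fixFrame_fixVar]
    exact sum_fixCoord3_smul (hY _) (hY0 _)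
  · rw [dirOf_fixFrame_tree _ he, htree e he]

/-- `|fixCoord Y|² ≤ 3·Σ_w ‖Y w‖_F²`. [folklore] -/
theorem fixCoord_sq_le (Y : ((Fin (2 * L - 1 + 1) × Edge 3 L) ⊕ Site 3 L) → Matrix (Fin 2) (Fin 2) ℂ) : fixCoord Y ⬝ᵥ fixCoord Y ≤ 3 * ∑ w, ‖Y w‖ ^ 2 := by
  classical
  have h1 : fixCoord Y ⬝ᵥ fixCoord Y = ∑ v : FixVar L, ∑ a, fixCoord3 (Y (fixVar v)) a ^ 2 := by
    rw [dotProduct, Fintype.sum_prod_type]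
    refine Finset.sum_congr rfl fun v _ => Finset.sum_congr rfl fun a _ => ?_
    rw [fixCoord, sq]
  rw [h1]
  have h2 : ∑ v : FixVar L, ∑ a, fixCoord3 (Y (fixVar v)) a ^ 2 ≤ ∑ v : FixVar L, 3 * ‖Y (fixVar v)‖ ^ 2 :=
    Finset.sum_le_sum fun v _ => sum_fixCoord3_sq_le _
  have h3 : ∑ v : FixVar L, 3 * ‖Y (fixVar v)‖ ^ 2 ≤ 3 * ∑ w, ‖Y w‖ ^ 2 := by
    rw [← Finset.mul_sum]
    refine mul_le_mul_of_nonneg_left ?_ (by norm_num)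
    rw [← Finset.sum_image (f := fun w => ‖Y w‖ ^ 2) (fun v _ v' _ h => fixVar_injective h)]
    exact Finset.sum_le_sum_of_subset_of_nonneg (Finset.subset_univ _) fun w _ _ => by positivity
  exact h2.trans h3

/-! ## §3 The chart at a point: nearby tree-gauged ring histories -/

/-- ★★★ **`fixFrame` coordinates of a nearby ring history with the same slice-0 tree links.**  If `Q.1 0 e = P.1 0 e` on the tree links and
`‖Q_w − P_w‖_F < 1/4` slot by slot, then `Q = P·multiCurve (dirOf fixFrame u) 1` for some `u : FixVar L × Fin 3 → ℝ` with
`u·u ≤ 12·(Σ_{i,e}‖Q.1 i e − P.1 i e‖² + Σ_x‖Q.2 x − P.2 x‖²)` — the input (ii) of the master estimates on the host `X_fix`, once `Q` is a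
(tree-gauged) zero of `F₀` near `P`. [folklore] -/
theorem exists_fixCoord_of_near (P Q : ((Fin (2 * L - 1 + 1) → GaugeConfig 3 L SU2) × (Site 3 L → SU2))) (htree : ∀ e : Edge 3 L, treeEdge e = true → Q.1 0 e = P.1 0 e)
    (hnear1 : ∀ (i : Fin (2 * L - 1 + 1)) (e : Edge 3 L),
      ‖(Q.1 i e : Matrix (Fin 2) (Fin 2) ℂ) - (P.1 i e : Matrix (Fin 2) (Fin 2) ℂ)‖ < 1 / 4)
    (hnear2 : ∀ x : Site 3 L, ‖(Q.2 x : Matrix (Fin 2) (Fin 2) ℂ) - (P.2 x : Matrix (Fin 2) (Fin 2) ℂ)‖ < 1 / 4) :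
    ∃ u : FixVar L × Fin 3 → ℝ,
      P * multiCurve (dirOf (fixFrame (L := L)) u) (dirOf_conjTranspose (fun j w => fixFrame_conjTranspose j w) u)
          (dirOf_trace (fun j w => fixFrame_trace j w) u) 1 = Q ∧
      u ⬝ᵥ u ≤ 12 * ((∑ i : Fin (2 * L - 1 + 1), ∑ e : Edge 3 L,
          ‖(Q.1 i e : Matrix (Fin 2) (Fin 2) ℂ) - (P.1 i e : Matrix (Fin 2) (Fin 2) ℂ)‖ ^ 2) +
        ∑ x : Site 3 L, ‖(Q.2 x : Matrix (Fin 2) (Fin 2) ℂ) - (P.2 x : Matrix (Fin 2) (Fin 2) ℂ)‖ ^ 2) := by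
  classical
  obtain ⟨Y, hY, hY0, hPQ, hY1, hY2⟩ := exists_multiCurve_eq_of_near P Q hnear1 hnear2
  have hYtree : ∀ e : Edge 3 L, treeEdge e = true → Y (Sum.inl (0, e)) = 0 := by
    intro e he
    have h := hY1 0 e
    rw [htree e he, sub_self, norm_zero, mul_zero] at h
    exact norm_le_zero_iff.mp h
  refine ⟨fixCoord Y, ?_, ?_⟩
  · have hdir : dirOf (fixFrame (L := L)) (fixCoord Y) = Y := dirOf_fixFrame_fixCoord hY hY0 hYtree
    have hmc : ∀ (Y₁ Y₂ : ((Fin (2 * L - 1 + 1) × Edge 3 L) ⊕ Site 3 L) → Matrix (Fin 2) (Fin 2) ℂ) (h₁ : ∀ w, (Y₁ w)ᴴ = -Y₁ w) (h₁0 : ∀ w, (Y₁ w).trace = 0)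
        (h₂ : ∀ w, (Y₂ w)ᴴ = -Y₂ w) (h₂0 : ∀ w, (Y₂ w).trace = 0), Y₁ = Y₂ → multiCurve Y₁ h₁ h₁0 1 = multiCurve Y₂ h₂ h₂0 1 := by
      intro Y₁ Y₂ h₁ h₁0 h₂ h₂0 h
      subst h
      rfl
    rw [hmc _ _ _ _ hY hY0 hdir]
    exact hPQ
  · have h1 := fixCoord_sq_le (L := L) Y
    have hsplit : ∑ w : ((Fin (2 * L - 1 + 1) × Edge 3 L) ⊕ Site 3 L), ‖Y w‖ ^ 2 =
        (∑ i : Fin (2 * L - 1 + 1), ∑ e : Edge 3 L, ‖Y (Sum.inl (i, e))‖ ^ 2) + ∑ x : Site 3 L, ‖Y (Sum.inr x)‖ ^ 2 := by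
      rw [Fintype.sum_sum_type, Fintype.sum_prod_type]
    have h2 : (∑ i : Fin (2 * L - 1 + 1), ∑ e : Edge 3 L, ‖Y (Sum.inl (i, e))‖ ^ 2) ≤
        ∑ i : Fin (2 * L - 1 + 1), ∑ e : Edge 3 L, (2 * ‖(Q.1 i e : Matrix (Fin 2) (Fin 2) ℂ) - (P.1 i e : Matrix (Fin 2) (Fin 2) ℂ)‖) ^ 2 :=
      Finset.sum_le_sum fun i _ => Finset.sum_le_sum fun e _ => pow_le_pow_left₀ (norm_nonneg _) (hY1 i e) 2
    have h3 : ∑ x : Site 3 L, ‖Y (Sum.inr x)‖ ^ 2 ≤ ∑ x : Site 3 L, (2 * ‖(Q.2 x : Matrix (Fin 2) (Fin 2) ℂ) - (P.2 x : Matrix (Fin 2) (Fin 2) ℂ)‖) ^ 2 :=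
      Finset.sum_le_sum fun x _ => pow_le_pow_left₀ (norm_nonneg _) (hY2 x) 2
    have e2 : ∑ i : Fin (2 * L - 1 + 1), ∑ e : Edge 3 L, (2 * ‖(Q.1 i e : Matrix (Fin 2) (Fin 2) ℂ) - (P.1 i e : Matrix (Fin 2) (Fin 2) ℂ)‖) ^ 2 =
        4 * ∑ i : Fin (2 * L - 1 + 1), ∑ e : Edge 3 L, ‖(Q.1 i e : Matrix (Fin 2) (Fin 2) ℂ) - (P.1 i e : Matrix (Fin 2) (Fin 2) ℂ)‖ ^ 2 := by
      rw [Finset.mul_sum]; refine Finset.sum_congr rfl fun i _ => ?_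
      rw [Finset.mul_sum]; refine Finset.sum_congr rfl fun e _ => by ring
    have e3 : ∑ x : Site 3 L, (2 * ‖(Q.2 x : Matrix (Fin 2) (Fin 2) ℂ) - (P.2 x : Matrix (Fin 2) (Fin 2) ℂ)‖) ^ 2 =
        4 * ∑ x : Site 3 L, ‖(Q.2 x : Matrix (Fin 2) (Fin 2) ℂ) - (P.2 x : Matrix (Fin 2) (Fin 2) ℂ)‖ ^ 2 := by
      rw [Finset.mul_sum]; refine Finset.sum_congr rfl fun x _ => by ring
    rw [hsplit] at h1
    linarith

end Summit.QuantumFields.YangMills.Theorems.VirialFluxGap.FrameHessian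

end
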